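import Mathlib.FieldTheory.Normal.Closure
import Mathlib.FieldTheory.IntermediateField.Algebraic
import HarnessLib

/-!
# Degree of the normal closure of an abstract finite extension

Topic `FieldTheory/Galois`; theorems only, Mathlib-only imports.  Setting: a field extension
`K/F` given as an ABSTRACT `F`-algebra `K` (not as an intermediate field), a second extension
`L/F`, and Mathlib's normal closure `normalClosure F K L = ⨆ f : K →ₐ[F] L, f.fieldRange`
(an intermediate field of `L/F`).  Mathlib decides normality by the normal closure only for
`K : IntermediateField F L` (`IntermediateField.normal_iff_normalClosure_eq`,
`IntermediateField.normalClosure_of_normal`); the statements below are the versions for an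
abstract `K` equipped with at least one `F`-embedding `K →ₐ[F] L` — the form in which they are
used for a number field `K` and `L = ℚ̄ ⊂ ℂ` (every complex embedding of a NORMAL number field
has the same image, and a number field is normal as soon as its Galois closure is no bigger
than the field).

* `normalClosure_eq_fieldRange_of_normal`: if `K/F` is normal, EVERY `F`-embedding
  `f : K →ₐ[F] L` fills the normal closure, `normalClosure F K L = f.fieldRange`; hence
  `nonempty_algEquiv_normalClosure_of_normal : Nonempty (K ≃ₐ[F] normalClosure F K L)` and
  `finrank_normalClosure_eq_of_normal : finrank F (normalClosure F K L) = finrank F K`.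
* `finrank_dvd_finrank_normalClosure`, `finrank_le_finrank_normalClosure`:
  `[K : F] ∣ [normalClosure F K L : F]` (and `≤` for `K/F` finite), given one embedding.
* `normal_of_finrank_normalClosure_le` (`L/F` normal, `K/F` finite, one embedding): if
  `[normalClosure F K L : F] ≤ [K : F]` then `K/F` is normal; packaged as
  `normal_iff_finrank_normalClosure_eq` and `finrank_lt_finrank_normalClosure_iff_not_normal`.
* `not_normalClosure_le_of_not_normal`: the normal closure of a NON-normal `K₁` is not contained
  in that of a normal `K₂` with `[K₂ : F] ≤ [K₁ : F]` (so the two closures differ).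
* Tower corollaries (`[Algebra K L] [IsScalarTower F K L]`, the embedding being
  `IsScalarTower.toAlgHom F K L`): primed names.

Design: the embedding is an instance argument `[Nonempty (K →ₐ[F] L)]`, as in Mathlib's
`isNormalClosure_normalClosure`; no definitions, no instances.  Deliberately NOT here: the
corollary "two embeddings of a normal `K` have the same image", which the tree already has as
`Literature.NumberTheory.GaloisRepresentations.fieldRange_eq_fieldRange_of_normal` (same proof
idea; it is `normalClosure_eq_fieldRange_of_normal f ▸ normalClosure_eq_fieldRange_of_normal g`);
anything on the Galois group of the normal closure; and the upper bound
`[normalClosure : F] ≤ nⁿ`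
(`Literature.NumberTheory.NumberFields.HermiteFiniteness.finrank_normalClosure_le`).

## References

Standard field theory (the normal closure as the compositum of the conjugates `σK`; `K/F` is
normal iff `σK = K` for all `σ`), e.g. S. Lang, *Algebra*, rev. 3rd ed., Ch. V §3,
Thm. 3.3–3.4; Stacks Project Tag 0BMG / 09HQ. [folklore]
-/

namespace Literature.FieldTheory.Galois

open IntermediateField Module

variable {F K L : Type*} [Field F] [Field K] [Field L] [Algebra F K] [Algebra F L]

/-! ## 1. A normal `K`: every embedding fills the normal closure -/

/-- **Every embedding of a normal extension fills its normal closure.**  If `K/F` is normal then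
for every `F`-embedding `f : K →ₐ[F] L` the normal closure of `K` in `L` is exactly the image
`f(K)`: all embeddings `K →ₐ[F] L` have the same image.  (Lang, *Algebra*, Ch. V §3, Thm. 3.3.)
[folklore] -/
theorem normalClosure_eq_fieldRange_of_normal [Normal F K] (f : K →ₐ[F] L) :
    normalClosure F K L = f.fieldRange := by
  haveI : Normal F f.fieldRange := Normal.of_algEquiv f.equivFieldRange
  refine le_antisymm (normalClosure_le_iff.mpr fun g => ?_) f.fieldRange_le_normalClosure
  rintro _ ⟨x, rfl⟩
  have key := AlgHom.fieldRange_of_normal (g.comp f.equivFieldRange.symm.toAlgHom)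
  have hx : g x ∈ (g.comp f.equivFieldRange.symm.toAlgHom).fieldRange :=
    ⟨f.equivFieldRange x, by simp⟩
  rwa [key] at hx

/-- If `K/F` is normal and embeds into `L`, then `K` is `F`-isomorphic to its normal closure in
`L` (along any embedding). [folklore] -/
theorem nonempty_algEquiv_normalClosure_of_normal [Normal F K] [ne : Nonempty (K →ₐ[F] L)] :
    Nonempty (K ≃ₐ[F] normalClosure F K L) := by
  obtain ⟨f⟩ := ne
  exact ⟨f.equivFieldRange.trans (equivOfEq (normalClosure_eq_fieldRange_of_normal f).symm)⟩

/-- **`[normalClosure F K L : F] = [K : F]` for a normal `K/F`** embedding into `L`.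
[folklore] -/
theorem finrank_normalClosure_eq_of_normal [Normal F K] [ne : Nonempty (K →ₐ[F] L)] :
    finrank F (normalClosure F K L) = finrank F K := by
  obtain ⟨e⟩ := nonempty_algEquiv_normalClosure_of_normal (F := F) (K := K) (L := L)
  exact e.toLinearEquiv.finrank_eq.symm

/-! ## 2. The degree of the normal closure is a multiple of the degree -/

/-- **`[K : F] ∣ [normalClosure F K L : F]`** as soon as `K` embeds into `L` over `F`
(`finrank` convention: both sides are `0` for an infinite extension). [folklore] -/
theorem finrank_dvd_finrank_normalClosure [ne : Nonempty (K →ₐ[F] L)] :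
    finrank F K ∣ finrank F (normalClosure F K L) := by
  obtain ⟨f⟩ := ne
  rw [f.equivFieldRange.toLinearEquiv.finrank_eq]
  exact finrank_dvd_of_le_right f.fieldRange_le_normalClosure

/-- **`[K : F] ≤ [normalClosure F K L : F]`** for a finite `K/F` embedding into `L`: the normal
closure is at least as big as the field. [folklore] -/
theorem finrank_le_finrank_normalClosure [FiniteDimensional F K] [ne : Nonempty (K →ₐ[F] L)] :
    finrank F K ≤ finrank F (normalClosure F K L) := by
  obtain ⟨f⟩ := ne
  rw [f.equivFieldRange.toLinearEquiv.finrank_eq]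
  exact finrank_le_of_le_right f.fieldRange_le_normalClosure

/-! ## 3. Normality is decided by the degree of the normal closure -/

/-- **A finite extension whose normal closure is no bigger than itself is normal.**  Let `L/F` be
normal and `K/F` finite with an embedding `f : K →ₐ[F] L`; if
`[normalClosure F K L : F] ≤ [K : F]` then `f(K)` is the whole normal closure, hence `K/F` is
normal.  (Lang, *Algebra*, Ch. V §3, Thm. 3.4: `K/F` is normal iff every embedding over `F` into
a normal overfield maps `K` onto itself.) [folklore] -/
theorem normal_of_finrank_normalClosure_le [FiniteDimensional F K] [Normal F L]
    [ne : Nonempty (K →ₐ[F] L)] (h : finrank F (normalClosure F K L) ≤ finrank F K) :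
    Normal F K := by
  obtain ⟨f⟩ := ne
  have hle : f.fieldRange ≤ normalClosure F K L := f.fieldRange_le_normalClosure
  have heq : f.fieldRange = normalClosure F K L :=
    eq_of_le_of_finrank_eq hle (le_antisymm (finrank_le_of_le_right hle)
      (by rw [← f.equivFieldRange.toLinearEquiv.finrank_eq]; exact h))
  haveI : Normal F f.fieldRange := by rw [heq]; infer_instance
  exact Normal.of_algEquiv f.equivFieldRange.symm

/-- **`K/F` is normal iff `[normalClosure F K L : F] = [K : F]`** (`L/F` normal, `K/F` finite,
`K` embedding into `L`). [folklore] -/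
theorem normal_iff_finrank_normalClosure_eq [FiniteDimensional F K] [Normal F L]
    [Nonempty (K →ₐ[F] L)] : Normal F K ↔ finrank F (normalClosure F K L) = finrank F K :=
  ⟨fun _ => finrank_normalClosure_eq_of_normal,
    fun h => normal_of_finrank_normalClosure_le h.le⟩

/-- **`[K : F] < [normalClosure F K L : F]` iff `K/F` is not normal** (`L/F` normal, `K/F`
finite, `K` embedding into `L`). [folklore] -/
theorem finrank_lt_finrank_normalClosure_iff_not_normal [FiniteDimensional F K] [Normal F L]
    [Nonempty (K →ₐ[F] L)] :
    finrank F K < finrank F (normalClosure F K L) ↔ ¬ Normal F K := by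
  rw [normal_iff_finrank_normalClosure_eq (F := F) (K := K) (L := L), lt_iff_le_and_ne]
  exact ⟨fun h he => h.2 he.symm,
    fun h => ⟨finrank_le_finrank_normalClosure, fun he => h he.symm⟩⟩

/-! ## 4. Comparing the normal closures of two fields -/

section TwoFields

variable {K₁ K₂ : Type*} [Field K₁] [Field K₂] [Algebra F K₁] [Algebra F K₂]

/-- **The normal closure of a non-normal field does not fit inside that of a normal field of no
larger degree**: if `K₁/F` is finite and not normal, `K₂/F` is finite normal with
`[K₂ : F] ≤ [K₁ : F]`,
and both embed into the normal extension `L/F`, then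
`normalClosure F K₁ L ⊄ normalClosure F K₂ L` (degrees: `[K₁:F] < [N₁:F]` while
`[N₂:F] = [K₂:F] ≤ [K₁:F]`; finiteness of `K₂` is needed — for `K₂ = L` infinite normal the
inclusion holds). [folklore] -/
theorem not_normalClosure_le_of_not_normal [FiniteDimensional F K₁] [FiniteDimensional F K₂]
    [Normal F L] [Nonempty (K₁ →ₐ[F] L)] [Nonempty (K₂ →ₐ[F] L)] (hn : ¬ Normal F K₁)
    [Normal F K₂] (hd : finrank F K₂ ≤ finrank F K₁) :
    ¬ normalClosure F K₁ L ≤ normalClosure F K₂ L := fun h =>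
  hn (normal_of_finrank_normalClosure_le ((finrank_le_of_le_right h).trans
    ((finrank_normalClosure_eq_of_normal (K := K₂)).le.trans hd)))

/-- In particular the two normal closures differ. [folklore] -/
theorem normalClosure_ne_of_not_normal [FiniteDimensional F K₁] [FiniteDimensional F K₂]
    [Normal F L] [Nonempty (K₁ →ₐ[F] L)] [Nonempty (K₂ →ₐ[F] L)] (hn : ¬ Normal F K₁)
    [Normal F K₂] (hd : finrank F K₂ ≤ finrank F K₁) :
    normalClosure F K₁ L ≠ normalClosure F K₂ L :=
  fun h => not_normalClosure_le_of_not_normal hn hd h.le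

end TwoFields

/-! ## 5. Tower corollaries (`F ⊆ K ⊆ L`) -/

section Tower

variable [Algebra K L] [IsScalarTower F K L]

/-- Tower form of `finrank_le_finrank_normalClosure`: for `F ⊆ K ⊆ L` with `K/F` finite,
`[K : F] ≤ [normalClosure F K L : F]`. [folklore] -/
theorem finrank_le_finrank_normalClosure' [FiniteDimensional F K] :
    finrank F K ≤ finrank F (normalClosure F K L) :=
  finrank_le_finrank_normalClosure (ne := ⟨IsScalarTower.toAlgHom F K L⟩)

/-- Tower form of `normal_iff_finrank_normalClosure_eq`: for `F ⊆ K ⊆ L` with `L/F` normal and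
`K/F` finite, `K/F` is normal iff `[normalClosure F K L : F] = [K : F]`. [folklore] -/
theorem normal_iff_finrank_normalClosure_eq' [FiniteDimensional F K] [Normal F L] :
    Normal F K ↔ finrank F (normalClosure F K L) = finrank F K :=
  haveI : Nonempty (K →ₐ[F] L) := ⟨IsScalarTower.toAlgHom F K L⟩
  normal_iff_finrank_normalClosure_eq

end Tower

end Literature.FieldTheory.Galois
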